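import Summits.NavierStokesRegularity.NavierStokesRegularity.Theses.HodographBetchov
import Summits.NavierStokesRegularity.NavierStokesRegularity.Theorems.HodographBetchovClassBudgetsRegulariseStubEnstrophyBound
import Summits.NavierStokesRegularity.NavierStokesRegularity.Theorems.HodographBetchovClassBudgetsRegulariseStubEnstrophyContinuation

/-!
# Support item `HodographBetchov.LocalisedMiller` (stmt-NavierStokesRegularity-15833) — PROVED

Route `HodographBetchov` of `NavierStokesRegularity`, support item LOCALISED MILLER (card T2; the
per-solution core of the bridge crux `ClassBudgetsRegularise`): for a classical solution `(u, p)` of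
the unforced Navier–Stokes system on `ℝ³ × [0, T)` which is Leray–Hopf from a rapidly decaying datum
`u 0`, and a speed level `l > 0`, the slow-class production bound at `l` (the conclusion of crux
`SlowClassProduction` at `l`) together with the fast-class Miller–Serrin squeeze at `l` (the
conclusion of crux `FastClassSqueeze` at `l`) implies that `u` extends smoothly past `T`.

The registered birth skeleton of the bridge crux (`Cruxes/ClassBudgetsRegularise/Lines/birth.lean`)
cut exactly this statement in two, and both halves are theorems of the tree:

* `ClassBudgetsRegularise.Birth.stub_classBudgetEnstrophyBound`
  (`Theorems/HodographBetchovClassBudgetsRegulariseStubEnstrophyBound.lean`): the two class budgets at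
  one level bound the enstrophy `∫ |∇u(t)|²` uniformly on `[0, T)` — Betchov's split
  `⟪ω, ∇u ω⟫ − 4 det ∇u = −4 det S`, the decay-free velocity-class null-Lagrangian identities
  `∫_{‖u‖ ≤ l} det ∇u = ∫ det ∇u = 0`, Miller's Lemma 5.1 in two-frame form on the fast class,
  Hölder–Gagliardo–Nirenberg–Young absorption, the slow class paying with its time-integrated
  production, Grönwall in Tao's class and identification with `u` by Majda–Bertozzi uniqueness;
* `ClassBudgetsRegularise.Birth.stub_enstrophyContinuation`
  (`Theorems/HodographBetchovClassBudgetsRegulariseStubEnstrophyContinuation.lean`): a uniform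
  enstrophy bound on `[0, T)` continues the solution smoothly past `T` (Tao persistence of
  regularity + `H¹` continuation).

So the item is their composition (pure logic), which is what this file records.

References: E. Miller, Arch. Ration. Mech. Anal. 235 (2020) = arXiv:1710.05569, Thm. 1.1 and
Lemma 5.1; R. Betchov, J. Fluid Mech. 1 (1956); T. Tao, Anal. PDE 6 (2013), Cor. 11.1;
J. T. Beale, T. Kato, A. Majda, Comm. Math. Phys. 94 (1984).
-/

noncomputable section

open Set MeasureTheory Filter Topology Function
open scoped ENNReal NNReal InnerProductSpace

-- the summit and its single sub-problem share the name (CONVENTIONS §1), as in every Theorems file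
set_option linter.dupNamespace false

namespace Summit.NavierStokesRegularity.NavierStokesRegularity.Theorems

open Literature.Analysis Literature.Analysis.FluidPDE

/-- **Support item `LocalisedMiller` of route `HodographBetchov` (stmt-NavierStokesRegularity-15833),
proved.** For `ν > 0`, `T > 0`, a classical solution `(u, p)` of the unforced Navier–Stokes system
on `[0, T)` which is Leray–Hopf from the rapidly decaying datum `u 0`, and a level `l > 0`: the
slow-class production bound at `l` and the fast-class Miller–Serrin squeeze at `l` give a smooth
extension of `u` past `T`. Proof: the class budgets bound the enstrophy on `[0, T)`
(`ClassBudgetsRegularise.Birth.stub_classBudgetEnstrophyBound`), and bounded enstrophy continues the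
solution (`ClassBudgetsRegularise.Birth.stub_enstrophyContinuation`).
[cite: Miller2019, Thm 1.1 (proof of Thm 5.2) and Lemma 5.1] -/
theorem localisedMiller_proof :
    Summit.NavierStokesRegularity.NavierStokesRegularity.Theses.HodographBetchov.LocalisedMiller := by
  unfold Summit.NavierStokesRegularity.NavierStokesRegularity.Theses.HodographBetchov.LocalisedMiller
  intro ν T hν hT u p hcl hLH hdec l hl hslow hfast
  -- stub 1 bounds the enstrophy on `[0, T)` from the two class budgets at level `l`,
  -- stub 2 continues the solution past `T`
  exact ClassBudgetsRegularise.Birth.stub_enstrophyContinuation ν T hν hT u p hcl hLH hdec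
    (ClassBudgetsRegularise.Birth.stub_classBudgetEnstrophyBound ν T hν hT u p hcl hLH hdec l hl
      hslow hfast)

end Summit.NavierStokesRegularity.NavierStokesRegularity.Theorems

end
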